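import Summits.NavierStokesRegularity.NavierStokesRegularity.Theorems.FilamentSkeletonRssCoreLinearInvertibilityArnoldModeOne1DNeutral

/-!
# Tools for stub `stub_arnoldModeOne1D` (crux `CoreLinearInvertibility`,
# stmt-NavierStokesRegularity-17973, route `FilamentSkeletonRss`, line `Sketch`) — part D: Bessel and deflation

The trace argument for the second eigenvalue of the `k = 1` mode operator
`B̃₁ = A^{-1/2} B₁ A^{-1/2}` (`A = Φ⁻¹`) on `L²(r dr)`: `B̃₁ = C̃*C̃` is positive with the explicit
factorisation `P(g) = ½∫ (A_g²/r³ + r B_g²)` (part B), its top eigenpair is `(1, a⋆)`; BESSEL's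
inequality in `L²(Φ⁻¹ s ds)` for the orthogonal pair `{a⋆/2, g/‖g‖}` applied to the representers
`Φ s 1_{(0,r]}` of `A_·(r)` and `Φ s⁻¹ 1_{(r,∞)}` of `B_·(r)`, integrated in `r`, gives
`P(a⋆)/4 + P(g)/Q(g) ≤ ½∫(F/r³ + rG) = ½∫ rΦ = tr B̃₁ ≤ 5/3`, i.e. the DEFLATION BOUND
`P(g) ≤ (2/3) Q(g)` for every Gaussian-class `g ⊥ a⋆` (`Q(g) = ∫ Φ⁻¹g² s`; true constant
`π²/6 − 1 ≈ 0.645`). Folklore; no definitions.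
-/

set_option linter.dupNamespace false

noncomputable section

namespace Summit.NavierStokesRegularity.NavierStokesRegularity.Theorems

open Set Function Filter MeasureTheory Topology
open Literature.Analysis.FluidPDE

/-! ### The weighted pairing with the neutral mode -/

/-- A discriminant lemma: `2ya − y²Q ≤ M` for all `y` and `Q ≥ 0` give `a² ≤ QM`. [folklore] -/
theorem am1_sq_le_of_forall {a Q M : ℝ} (hQ : 0 ≤ Q) (h : ∀ y : ℝ, 2 * y * a - y ^ 2 * Q ≤ M) :
    a ^ 2 ≤ Q * M := by
  rcases hQ.eq_or_lt with hQ0 | hQpos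
  · subst hQ0
    have ha : a = 0 := by
      by_contra ha
      have h1 := h ((M + 1) / (2 * a))
      have : 2 * ((M + 1) / (2 * a)) * a = M + 1 := by field_simp
      rw [this] at h1
      linarith
    subst ha
    simp
  · have h1 := h (a / Q)
    have : 2 * (a / Q) * a - (a / Q) ^ 2 * Q = a ^ 2 / Q := by field_simp; ring
    rw [this, div_le_iff₀ hQpos] at h1
    linarith

/-- `⟨a⋆, g⟩_{L²(Φ⁻¹ s ds)} = ∫₀^∞ 4(1 − e^{−s²/4}) g(s) ds` (`Φ⁻¹ a⋆ = 4(1−e^{−s²/4})/s`). [folklore] -/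
theorem am1_weight_aStar_mul (g : ℝ → ℝ) :
    ∫ s in Ioi (0 : ℝ), (kerWeight s)⁻¹ * (s * Real.exp (-(s ^ 2 / 4)) * g s) * s =
      ∫ s in Ioi (0 : ℝ), 4 * (1 - Real.exp (-(s ^ 2 / 4))) * g s := by
  refine setIntegral_congr_fun measurableSet_Ioi fun s hs => ?_
  have hs0 : s ≠ 0 := ne_of_gt hs
  calc (kerWeight s)⁻¹ * (s * Real.exp (-(s ^ 2 / 4)) * g s) * s
      = ((kerWeight s)⁻¹ * (s * Real.exp (-(s ^ 2 / 4)))) * g s * s := by ring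
    _ = 4 * (1 - Real.exp (-(s ^ 2 / 4))) / s * g s * s := by rw [am1_inv_kerWeight_mul_aStar hs0]
    _ = 4 * (1 - Real.exp (-(s ^ 2 / 4))) * g s := by field_simp

/-- `‖a⋆‖²_{L²(Φ⁻¹ s ds)} = 4`. [folklore] -/
theorem am1_Q_aStar :
    ∫ s in Ioi (0 : ℝ), (kerWeight s)⁻¹ *
      (s * Real.exp (-(s ^ 2 / 4)) * (s * Real.exp (-(s ^ 2 / 4)))) * s = 4 := by
  rw [am1_weight_aStar_mul, am1_integral_q_mul_aStar]

/-- `‖x a⋆ + y g‖² = 4x² + y²‖g‖²` in `L²(Φ⁻¹ s ds)` for `g ⊥ a⋆`, with integrability. [folklore] -/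
theorem am1_weight_sq_lin {g : ℝ → ℝ} (hg : Continuous g) {C : ℝ} {N : ℕ}
    (hb : ∀ r, 0 ≤ r → |g r| ≤ C * (1 + r) ^ N * Real.exp (-(r ^ 2 / 4)))
    (horth : ∫ s in Ioi (0 : ℝ), (kerWeight s)⁻¹ * (s * Real.exp (-(s ^ 2 / 4)) * g s) * s = 0)
    (x y : ℝ) :
    IntegrableOn (fun s : ℝ => (kerWeight s)⁻¹ *
        ((x * (s * Real.exp (-(s ^ 2 / 4))) + y * g s) * (x * (s * Real.exp (-(s ^ 2 / 4))) + y * g s)) * s)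
        (Ioi 0) ∧
      ∫ s in Ioi (0 : ℝ), (kerWeight s)⁻¹ *
        ((x * (s * Real.exp (-(s ^ 2 / 4))) + y * g s) * (x * (s * Real.exp (-(s ^ 2 / 4))) + y * g s)) * s =
        4 * x ^ 2 + y ^ 2 * ∫ s in Ioi (0 : ℝ), (kerWeight s)⁻¹ * (g s * g s) * s := by
  have haS : Continuous fun s : ℝ => s * Real.exp (-(s ^ 2 / 4)) := by fun_prop
  have Iaa := am1_integrableOn_weight_mul_mul haS haS am1_gc_aStar am1_gc_aStar
  have Iag := am1_integrableOn_weight_mul_mul haS hg am1_gc_aStar hb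
  have Igg := am1_integrableOn_weight_mul_mul hg hg hb hb
  have hpt : (fun s : ℝ => (kerWeight s)⁻¹ *
      ((x * (s * Real.exp (-(s ^ 2 / 4))) + y * g s) * (x * (s * Real.exp (-(s ^ 2 / 4))) + y * g s)) * s) =
      fun s : ℝ => x ^ 2 * ((kerWeight s)⁻¹ * (s * Real.exp (-(s ^ 2 / 4)) * (s * Real.exp (-(s ^ 2 / 4)))) * s) +
        2 * x * y * ((kerWeight s)⁻¹ * (s * Real.exp (-(s ^ 2 / 4)) * g s) * s) +
        y ^ 2 * ((kerWeight s)⁻¹ * (g s * g s) * s) := by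
    funext s; ring
  rw [hpt]
  have J1 : IntegrableOn (fun s : ℝ => x ^ 2 * ((kerWeight s)⁻¹ *
      (s * Real.exp (-(s ^ 2 / 4)) * (s * Real.exp (-(s ^ 2 / 4)))) * s)) (Ioi 0) := Iaa.const_mul _
  have J2 : IntegrableOn (fun s : ℝ => 2 * x * y * ((kerWeight s)⁻¹ *
      (s * Real.exp (-(s ^ 2 / 4)) * g s) * s)) (Ioi 0) := Iag.const_mul _
  have J3 : IntegrableOn (fun s : ℝ => y ^ 2 * ((kerWeight s)⁻¹ * (g s * g s) * s)) (Ioi 0) :=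
    Igg.const_mul _
  have J12 : IntegrableOn (fun s : ℝ => x ^ 2 * ((kerWeight s)⁻¹ *
      (s * Real.exp (-(s ^ 2 / 4)) * (s * Real.exp (-(s ^ 2 / 4)))) * s) + 2 * x * y * ((kerWeight s)⁻¹ *
      (s * Real.exp (-(s ^ 2 / 4)) * g s) * s)) (Ioi 0) := J1.add J2
  refine ⟨J12.add J3, ?_⟩
  rw [integral_add J12 J3, integral_add J1 J2, MeasureTheory.integral_const_mul,
    MeasureTheory.integral_const_mul, MeasureTheory.integral_const_mul, am1_Q_aStar, horth]
  ring

/-! ### Bessel's inequality for the representers of `A_·(r)` and `B_·(r)` -/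

/-- **Bessel, core part.** For a Gaussian-class `g ⊥ a⋆` in `L²(Φ⁻¹ s ds)`, `r > 0` and every `y`:
`2y A_g(r) − y² Q(g) ≤ F(r) − A⋆(r)²/4` (`F(r) = ∫₀ʳ s³Φ = ‖Φ s 1_{(0,r]}‖²`, `A⋆ = 8 − 2(r²+4)e^{−r²/4}`,
`‖a⋆‖² = 4`): expand `0 ≤ ‖Φ s 1_{(0,r]} − (A⋆(r)/4) a⋆ − y g‖²`. [folklore] -/
theorem am1_bessel_A {g : ℝ → ℝ} (hg : Continuous g) {C : ℝ} {N : ℕ}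
    (hb : ∀ r, 0 ≤ r → |g r| ≤ C * (1 + r) ^ N * Real.exp (-(r ^ 2 / 4)))
    (horth : ∫ s in Ioi (0 : ℝ), (kerWeight s)⁻¹ * (s * Real.exp (-(s ^ 2 / 4)) * g s) * s = 0)
    {r : ℝ} (hr : 0 < r) (y : ℝ) :
    2 * y * (∫ s in (0 : ℝ)..r, s ^ 2 * g s) -
        y ^ 2 * (∫ s in Ioi (0 : ℝ), (kerWeight s)⁻¹ * (g s * g s) * s) ≤
      (∫ s in (0 : ℝ)..r, s ^ 3 * kerWeight s) - (8 - 2 * (r ^ 2 + 4) * Real.exp (-(r ^ 2 / 4))) ^ 2 / 4 := by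
  set As : ℝ := 8 - 2 * (r ^ 2 + 4) * Real.exp (-(r ^ 2 / 4)) with hAs
  set x : ℝ := As / 4 with hx
  set w : ℝ → ℝ := fun s => x * (s * Real.exp (-(s ^ 2 / 4))) + y * g s with hw
  set Qg : ℝ := ∫ s in Ioi (0 : ℝ), (kerWeight s)⁻¹ * (g s * g s) * s with hQg
  obtain ⟨hwi, hwv⟩ := am1_weight_sq_lin hg hb horth x y
  have haS : Continuous fun s : ℝ => s * Real.exp (-(s ^ 2 / 4)) := by fun_prop
  have hwc : Continuous w := by simp only [hw]; fun_prop
  have hΦi : Continuous fun s : ℝ => (kerWeight s)⁻¹ :=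
    continuous_kerWeight.inv₀ fun s => (kerWeight_pos s).ne'
  -- piece `(0, r]`
  have hI1 : IntegrableOn (fun s : ℝ => s ^ 3 * kerWeight s) (Ioc 0 r) :=
    (((continuous_pow 3).mul continuous_kerWeight).integrableOn_Icc (a := 0) (b := r)).mono_set
      Ioc_subset_Icc_self
  have hI2 : IntegrableOn (fun s : ℝ => s ^ 2 * w s) (Ioc 0 r) :=
    (((continuous_pow 2).mul hwc).integrableOn_Icc (a := 0) (b := r)).mono_set Ioc_subset_Icc_self
  have hI3 : IntegrableOn (fun s : ℝ => (kerWeight s)⁻¹ * (w s * w s) * s) (Ioc 0 r) :=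
    hwi.mono_set Ioc_subset_Ioi_self
  have h1 : 0 ≤ ∫ s in Ioc 0 r, (kerWeight s)⁻¹ * ((kerWeight s * s - w s) * (kerWeight s * s - w s)) * s :=
    setIntegral_nonneg measurableSet_Ioc fun s hs => mul_nonneg (mul_nonneg
      (inv_nonneg.2 (kerWeight_pos s).le) (mul_self_nonneg _)) hs.1.le
  have h1eq : (∫ s in Ioc 0 r, (kerWeight s)⁻¹ * ((kerWeight s * s - w s) * (kerWeight s * s - w s)) * s) =
      (∫ s in (0 : ℝ)..r, s ^ 3 * kerWeight s) - 2 * (x * As + y * ∫ s in (0 : ℝ)..r, s ^ 2 * g s) +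
        ∫ s in Ioc 0 r, (kerWeight s)⁻¹ * (w s * w s) * s := by
    have hpt : EqOn (fun s : ℝ => (kerWeight s)⁻¹ * ((kerWeight s * s - w s) * (kerWeight s * s - w s)) * s)
        (fun s : ℝ => s ^ 3 * kerWeight s - 2 * (s ^ 2 * w s) + (kerWeight s)⁻¹ * (w s * w s) * s) (Ioc 0 r) := by
      intro s _
      have hΦ : kerWeight s ≠ 0 := (kerWeight_pos s).ne'
      simp only
      field_simp
      ring
    have hI2' : IntegrableOn (fun s : ℝ => 2 * (s ^ 2 * w s)) (Ioc 0 r) := hI2.const_mul 2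
    have hI12 : IntegrableOn (fun s : ℝ => s ^ 3 * kerWeight s - 2 * (s ^ 2 * w s)) (Ioc 0 r) := hI1.sub hI2'
    rw [setIntegral_congr_fun measurableSet_Ioc hpt, integral_add hI12 hI3, integral_sub hI1 hI2',
      MeasureTheory.integral_const_mul, ← intervalIntegral.integral_of_le hr.le,
      ← intervalIntegral.integral_of_le hr.le]
    congr 2
    simp only [hw]
    have e1 : (∫ s in (0 : ℝ)..r, s ^ 2 * (x * (s * Real.exp (-(s ^ 2 / 4))) + y * g s)) =
        x * (∫ s in (0 : ℝ)..r, s ^ 2 * (s * Real.exp (-(s ^ 2 / 4)))) + y * ∫ s in (0 : ℝ)..r, s ^ 2 * g s := by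
      rw [← intervalIntegral.integral_const_mul, ← intervalIntegral.integral_const_mul,
        ← intervalIntegral.integral_add]
      · refine intervalIntegral.integral_congr fun s _ => ?_
        ring
      · exact ((((continuous_pow 2).mul haS)).const_mul x).intervalIntegrable _ _
      · exact (((continuous_pow 2).mul hg).const_mul y).intervalIntegrable _ _
    rw [e1, am1_integral_sq_mul_aStar r]
  -- piece `(r, ∞)`
  have h2 : 0 ≤ ∫ s in Ioi r, (kerWeight s)⁻¹ * (w s * w s) * s :=
    setIntegral_nonneg measurableSet_Ioi fun s hs => mul_nonneg (mul_nonneg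
      (inv_nonneg.2 (kerWeight_pos s).le) (mul_self_nonneg _)) (hr.trans hs).le
  have hunion : (∫ s in Ioc 0 r, (kerWeight s)⁻¹ * (w s * w s) * s) +
      (∫ s in Ioi r, (kerWeight s)⁻¹ * (w s * w s) * s) = 4 * x ^ 2 + y ^ 2 * Qg := by
    rw [← hwv, ← setIntegral_union (Ioc_disjoint_Ioi le_rfl) measurableSet_Ioi hI3
      (hwi.mono_set (Ioi_subset_Ioi hr.le)), Ioc_union_Ioi_eq_Ioi hr.le]
  have hxv : 4 * x ^ 2 - 2 * (x * As) = -(As ^ 2 / 4) := by rw [hx]; ring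
  linarith

/-- **Bessel, tail part.** For a Gaussian-class `g ⊥ a⋆`, `r > 0` and every `y`:
`2y B_g(r) − y² Q(g) ≤ G(r) − e^{−r²/2}` (`G(r) = ∫ᵣ^∞ Φ/s = ‖Φ s⁻¹ 1_{(r,∞)}‖²`,
`B⋆(r)²/4 = e^{−r²/2}`): expand `0 ≤ ‖Φ s⁻¹ 1_{(r,∞)} − (B⋆(r)/4) a⋆ − y g‖²`. [folklore] -/
theorem am1_bessel_B {g : ℝ → ℝ} (hg : Continuous g) {C : ℝ} {N : ℕ}
    (hb : ∀ r, 0 ≤ r → |g r| ≤ C * (1 + r) ^ N * Real.exp (-(r ^ 2 / 4)))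
    (horth : ∫ s in Ioi (0 : ℝ), (kerWeight s)⁻¹ * (s * Real.exp (-(s ^ 2 / 4)) * g s) * s = 0)
    {r : ℝ} (hr : 0 < r) (y : ℝ) :
    2 * y * (∫ s in Ioi r, g s) - y ^ 2 * (∫ s in Ioi (0 : ℝ), (kerWeight s)⁻¹ * (g s * g s) * s) ≤
      (∫ s in Ioi r, kerWeight s / s) - Real.exp (-(r ^ 2 / 4)) ^ 2 := by
  set Er : ℝ := Real.exp (-(r ^ 2 / 4)) with hEr
  set x : ℝ := Er / 2 with hx
  set w : ℝ → ℝ := fun s => x * (s * Real.exp (-(s ^ 2 / 4))) + y * g s with hw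
  set Qg : ℝ := ∫ s in Ioi (0 : ℝ), (kerWeight s)⁻¹ * (g s * g s) * s with hQg
  obtain ⟨hwi, hwv⟩ := am1_weight_sq_lin hg hb horth x y
  have haS : Continuous fun s : ℝ => s * Real.exp (-(s ^ 2 / 4)) := by fun_prop
  have hgi : IntegrableOn g (Ioi 0) :=
    (am1_integrableOn_pow_mul hg hb 0).congr_fun (fun r _ => by simp) measurableSet_Ioi
  have hai : IntegrableOn (fun s : ℝ => s * Real.exp (-(s ^ 2 / 4))) (Ioi 0) :=
    (am1_integrableOn_pow_mul haS am1_gc_aStar 0).congr_fun (fun r _ => by simp) measurableSet_Ioi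
  -- piece `(r, ∞)`
  have hI1 : IntegrableOn (fun s : ℝ => kerWeight s / s) (Ioi r) := (am1_G_bounds hr).1
  have hax : IntegrableOn (fun s : ℝ => x * (s * Real.exp (-(s ^ 2 / 4)))) (Ioi r) :=
    (hai.mono_set (Ioi_subset_Ioi hr.le)).const_mul x
  have hgy : IntegrableOn (fun s : ℝ => y * g s) (Ioi r) := (hgi.mono_set (Ioi_subset_Ioi hr.le)).const_mul y
  have hI2 : IntegrableOn w (Ioi r) := hax.add hgy
  have hI3 : IntegrableOn (fun s : ℝ => (kerWeight s)⁻¹ * (w s * w s) * s) (Ioi r) :=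
    hwi.mono_set (Ioi_subset_Ioi hr.le)
  have h1 : 0 ≤ ∫ s in Ioi r, (kerWeight s)⁻¹ * ((kerWeight s / s - w s) * (kerWeight s / s - w s)) * s :=
    setIntegral_nonneg measurableSet_Ioi fun s hs => mul_nonneg (mul_nonneg
      (inv_nonneg.2 (kerWeight_pos s).le) (mul_self_nonneg _)) (hr.trans hs).le
  have h1eq : (∫ s in Ioi r, (kerWeight s)⁻¹ * ((kerWeight s / s - w s) * (kerWeight s / s - w s)) * s) =
      (∫ s in Ioi r, kerWeight s / s) - 2 * (x * (2 * Er) + y * ∫ s in Ioi r, g s) +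
        ∫ s in Ioi r, (kerWeight s)⁻¹ * (w s * w s) * s := by
    have hpt : EqOn (fun s : ℝ => (kerWeight s)⁻¹ * ((kerWeight s / s - w s) * (kerWeight s / s - w s)) * s)
        (fun s : ℝ => kerWeight s / s - 2 * w s + (kerWeight s)⁻¹ * (w s * w s) * s) (Ioi r) := by
      intro s hs
      have hΦ : kerWeight s ≠ 0 := (kerWeight_pos s).ne'
      have hs0 : s ≠ 0 := ne_of_gt (hr.trans hs)
      simp only
      field_simp
      ring
    have hI2' : IntegrableOn (fun s : ℝ => 2 * w s) (Ioi r) := hI2.const_mul 2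
    have hI12 : IntegrableOn (fun s : ℝ => kerWeight s / s - 2 * w s) (Ioi r) := hI1.sub hI2'
    rw [setIntegral_congr_fun measurableSet_Ioi hpt, integral_add hI12 hI3, integral_sub hI1 hI2',
      MeasureTheory.integral_const_mul]
    congr 2
    simp only [hw]
    rw [integral_add hax hgy, MeasureTheory.integral_const_mul, MeasureTheory.integral_const_mul,
      am1_integral_Ioi_aStar hr.le]
  -- piece `(0, r]`
  have h2 : 0 ≤ ∫ s in Ioc 0 r, (kerWeight s)⁻¹ * (w s * w s) * s :=
    setIntegral_nonneg measurableSet_Ioc fun s hs => mul_nonneg (mul_nonneg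
      (inv_nonneg.2 (kerWeight_pos s).le) (mul_self_nonneg _)) hs.1.le
  have hunion : (∫ s in Ioc 0 r, (kerWeight s)⁻¹ * (w s * w s) * s) +
      (∫ s in Ioi r, (kerWeight s)⁻¹ * (w s * w s) * s) = 4 * x ^ 2 + y ^ 2 * Qg := by
    rw [← hwv, ← setIntegral_union (Ioc_disjoint_Ioi le_rfl) measurableSet_Ioi
      (hwi.mono_set Ioc_subset_Ioi_self) hI3, Ioc_union_Ioi_eq_Ioi hr.le]
  have hxv : 4 * x ^ 2 - 2 * (x * (2 * Er)) = -Er ^ 2 := by rw [hx]; ring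
  linarith

/-! ### The deflation bound -/

/-- **Deflation bound (second eigenvalue of the `k = 1` mode operator).** For a continuous
Gaussian-class `g` orthogonal to the neutral mode `a⋆` in `L²(Φ⁻¹ s ds)`,
`P(g) = ½∫₀^∞ (A_g²/r³ + r B_g²) dr ≤ (2/3) ∫₀^∞ Φ⁻¹ g² s ds`: Bessel pointwise in `r`
(`A_g² ≤ Q(F − A⋆²/4)`, `B_g² ≤ Q(G − B⋆²/4)`), integrated with the trace identities
(`∫F/r³ = ∫rG = ½∫rΦ`), the energy `4` of `a⋆`, and `∫ rΦ ≤ 10/3`: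
`P(g) ≤ ½ Q (∫rΦ − 2) ≤ (2/3) Q` (`λ₂(B̃₁) ≤ tr B̃₁ − 1 = π²/6 − 1`). [folklore] -/
theorem am1_deflation {g : ℝ → ℝ} (hg : Continuous g) {C : ℝ} {N : ℕ}
    (hb : ∀ r, 0 ≤ r → |g r| ≤ C * (1 + r) ^ N * Real.exp (-(r ^ 2 / 4)))
    (horth : ∫ s in Ioi (0 : ℝ), (kerWeight s)⁻¹ * (s * Real.exp (-(s ^ 2 / 4)) * g s) * s = 0) :
    (1 / 2) * ∫ r in Ioi (0 : ℝ), ((∫ s in (0 : ℝ)..r, s ^ 2 * g s) ^ 2 / r ^ 3 + r * (∫ s in Ioi r, g s) ^ 2) ≤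
      (2 / 3) * ∫ s in Ioi (0 : ℝ), (kerWeight s)⁻¹ * (g s * g s) * s := by
  set Q : ℝ := ∫ s in Ioi (0 : ℝ), (kerWeight s)⁻¹ * (g s * g s) * s with hQ
  set F : ℝ → ℝ := fun r => ∫ s in (0 : ℝ)..r, s ^ 3 * kerWeight s with hF
  set G : ℝ → ℝ := fun r => ∫ s in Ioi r, kerWeight s / s with hG
  set E : ℝ → ℝ := fun r => Real.exp (-(r ^ 2 / 4)) with hE
  set As : ℝ → ℝ := fun r => 8 - 2 * (r ^ 2 + 4) * E r with hAs
  have hQ0 : 0 ≤ Q := setIntegral_nonneg measurableSet_Ioi fun s hs =>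
    mul_nonneg (mul_nonneg (inv_nonneg.2 (kerWeight_pos s).le) (mul_self_nonneg _)) (le_of_lt hs)
  -- pointwise Bessel consequences
  have hA2 : ∀ r, 0 < r → (∫ s in (0 : ℝ)..r, s ^ 2 * g s) ^ 2 ≤ Q * (F r - As r ^ 2 / 4) := fun r hr =>
    am1_sq_le_of_forall hQ0 fun y => am1_bessel_A hg hb horth hr y
  have hB2 : ∀ r, 0 < r → (∫ s in Ioi r, g s) ^ 2 ≤ Q * (G r - E r ^ 2) := fun r hr =>
    am1_sq_le_of_forall hQ0 fun y => am1_bessel_B hg hb horth hr y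
  -- integrability
  have he := (am1_integrableOn_A_sq_div hg hb).add (am1_integrableOn_mul_B_sq hg hb)
  obtain ⟨hFi, hFv⟩ := am1_integral_F_div_cube
  obtain ⟨hGi, hGv⟩ := am1_integral_mul_G
  obtain ⟨hSi, hSv⟩ := am1_energy_aStar
  have hm : IntegrableOn (fun r : ℝ => Q * ((F r / r ^ 3 + r * G r) -
      (1 / 4) * (As r ^ 2 / r ^ 3 + r * (2 * E r) ^ 2))) (Ioi 0) :=
    ((hFi.add hGi).sub (hSi.const_mul (1 / 4))).const_mul Q
  have hle : (∫ r in Ioi (0 : ℝ), ((∫ s in (0 : ℝ)..r, s ^ 2 * g s) ^ 2 / r ^ 3 + r * (∫ s in Ioi r, g s) ^ 2)) ≤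
      ∫ r in Ioi (0 : ℝ), Q * ((F r / r ^ 3 + r * G r) - (1 / 4) * (As r ^ 2 / r ^ 3 + r * (2 * E r) ^ 2)) := by
    refine setIntegral_mono_on he hm measurableSet_Ioi fun r hr => ?_
    have hr0 : 0 < r := hr
    have hr3 : 0 < r ^ 3 := pow_pos hr0 3
    have h1 : (∫ s in (0 : ℝ)..r, s ^ 2 * g s) ^ 2 / r ^ 3 ≤ Q * (F r - As r ^ 2 / 4) / r ^ 3 :=
      div_le_div_of_nonneg_right (hA2 r hr0) hr3.le
    have h2 : r * (∫ s in Ioi r, g s) ^ 2 ≤ r * (Q * (G r - E r ^ 2)) :=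
      mul_le_mul_of_nonneg_left (hB2 r hr0) hr0.le
    have h3 : Q * (F r - As r ^ 2 / 4) / r ^ 3 + r * (Q * (G r - E r ^ 2)) =
        Q * ((F r / r ^ 3 + r * G r) - (1 / 4) * (As r ^ 2 / r ^ 3 + r * (2 * E r) ^ 2)) := by
      field_simp
      ring
    linarith
  have hval : (∫ r in Ioi (0 : ℝ), Q * ((F r / r ^ 3 + r * G r) - (1 / 4) * (As r ^ 2 / r ^ 3 + r * (2 * E r) ^ 2))) =
      Q * ((∫ r in Ioi (0 : ℝ), r * kerWeight r) - 2) := by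
    have hS4 : IntegrableOn (fun r : ℝ => (1 / 4) * (As r ^ 2 / r ^ 3 + r * (2 * E r) ^ 2)) (Ioi 0) :=
      hSi.const_mul (1 / 4)
    have hFG : IntegrableOn (fun r : ℝ => F r / r ^ 3 + r * G r) (Ioi 0) := hFi.add hGi
    have hS : (∫ r in Ioi (0 : ℝ), (As r ^ 2 / r ^ 3 + r * (2 * E r) ^ 2)) = 8 := by
      simp only [hAs, hE]
      linarith [hSv]
    rw [MeasureTheory.integral_const_mul, integral_sub hFG hS4, integral_add hFi hGi,
      MeasureTheory.integral_const_mul, hFv, hGv, hS]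
    ring
  have hΦ := am1_integral_mul_kerWeight_le
  rw [hval] at hle
  nlinarith [hle, hQ0, hΦ]

/-! ### The registered tools stub -/

/-- **Registered tools stub `stub_arnoldModeOne1DToolsE`** (helpers for `stub_arnoldModeOne1D`, line
`Sketch` of crux `CoreLinearInvertibility`, stmt-NavierStokesRegularity-17973): the deflation bound
`P(g) ≤ (2/3) Q(g)` for Gaussian-class `g ⊥ a⋆`. [folklore] -/
theorem stub_arnoldModeOne1DToolsE :
    ∀ (g : ℝ → ℝ) (C : ℝ) (N : ℕ), Continuous g →
      (∀ r : ℝ, 0 ≤ r → |g r| ≤ C * (1 + r) ^ N * Real.exp (-(r ^ 2 / 4))) →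
      (∫ s in Set.Ioi (0 : ℝ), (kerWeight s)⁻¹ * (s * Real.exp (-(s ^ 2 / 4)) * g s) * s = 0) →
      (1 / 2) * ∫ r in Set.Ioi (0 : ℝ),
          ((∫ s in (0 : ℝ)..r, s ^ 2 * g s) ^ 2 / r ^ 3 + r * (∫ s in Set.Ioi r, g s) ^ 2) ≤
        (2 / 3) * ∫ s in Set.Ioi (0 : ℝ), (kerWeight s)⁻¹ * (g s * g s) * s :=
  fun _ _ _ hg hb horth => am1_deflation hg hb horth

end Summit.NavierStokesRegularity.NavierStokesRegularity.Theorems
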